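import Summits.CriticalPhenomena.PercolationContinuityZ3.Theorems.PercNearOneGluingNoHeavyLowerTailThreePointProductFormPsiCone
import Summits.CriticalPhenomena.PercolationContinuityZ3.Theorems.PercNearOneGluingNoHeavyLowerTailThreePointProductFormModuleCone

/-!
# The visible-column sign law (gen 66 numerical law (L2), now a theorem): `x(m₋) + λ·y(m₋) ≤ 0` for every physical word and
# every `λ ∈ [51/40, 653/216]`; in particular the Perron covector and the `y`-generator of `K` pair NONPOSITIVELY with `m₋`
# (Sahi programme, box problem, prover prim-sahi-p2 gen 72)

Support file (`--supports stmt-CriticalPhenomena-4575`).  Standard axioms, no sorries, no named facts, no new definitions.  Memo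
`run/shared/lean/prim/prim-sahi/FROM-prim-sahi-p2-gen72-MODE-FAMILIES.md` §3, `prim-sahi-p2/PROOF-E3.md` §82.

THE STATEMENT.  For the 12-state normal form of the AM form `A = #P1 + #P2 − 2·#bad` of the one-child boundary-star cycle
(`…ProductFormABPlus`, `…ProductFormKrein`) driven by PHYSICAL letters `(s,d)` (`0 ≤ s ± d`), the visible copy-column `m₋ = colM`
satisfies, for every rational `λ` with `51/40 ≤ λ ≤ 653/216`,
    `(colM v).x + λ·(colM v).y ≤ 0`   on every state `v` reached from `ω`  (`colM_x_add_mul_y_nonpos`).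
The interval contains `23/8`, `51/20`, `3`, and the Perron root `λ₊ = (15+√65)/8 ≈ 2.8828` of the hub letter on the plane `E`
(`2.875 ≤ λ₊ ≤ 3.023`): the law with `λ = λ₊` is gen 66's numerical law (L2) "`ℓ₊(m₋) ≤ 0` on every physical word" (memo
FROM-prim-sahi-p2-gen66-KREIN-STRUCTURE §0 (L2)), which is what makes the `λ₊`-family ("visible injection, Perron growth") of the
AM form nonnegative in the mode-family analysis of gen 72 (memo §1–§3): along a hub tail `p^b` the a-part of `A` grows like
`λ₊^b · c · (−ℓ₊(m₋)) ≥ 0`.  Two corollaries in the tree's vocabulary: `β𝕄((−9,4,0), m₋) ≤ 0` — the `y`-generator `g₃ = (−9,4,0)`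
of the invariant cone `K` of `…ProductFormModuleCone` pairs nonpositively with `m₋` (`betaM_g3_colM_nonpos`; `β𝕄(g₃,·) =
(5/2)x + (51/8)y`, `λ = 51/20`) — and hence the Krein pairing `β𝕄(c·g₃, m₋(w)) ≥ 0` for every `c ≤ 0`, i.e. for the `g₃`-component
of any vector of `−K` such as `m₊(u) = colP` (`colP_negK`): the `E`-plane part of the second pair term `12000·β𝕄(m₋, m'₊)` of the
pair identity `coeff_append_coords` carries the right sign (`betaM_colM_smul_g3_nonneg`).

THE PROOF.  Three linear facets of LEMMA ψ's invariant cone `K_ψ = inKP` (`…ProductFormPsiDefs/PsiCone`, gen 66): with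
`n = −m₋`, `b = n₁ + (23/8)n₂ ≥ 0` (L2), `b₋ + b/4 ≥ 0` (L3), `(29/2)b − b₋ ≥ 0` (QWl), `b₋ = n₁ + (7/8)n₂`; then
`n₁ + λ n₂ = b − μ(b₋ − b)` with `μ = λ/2 − 23/16 ∈ [−4/5, 2/27]` and `b₋ − b ∈ [−(5/4)b, (27/2)b]`, so
`b − μ(b₋ − b) = (135/118)·[(2/27 − μ)(b + (4/5)(b₋ − b)) + (μ + 4/5)(b − (2/27)(b₋ − b))] ≥ 0`.  [this work] (gen 72).
-/

namespace Summit.CriticalPhenomena.PercolationContinuityZ3.Theorems.ProductFormABPlus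

open ProductFormCorners (V3)
open ProductFormModuleCone (c1 c2 c3 negK colP_negK)

/-- ★ THE VISIBLE-COLUMN SIGN LAW: for every physical word and every `λ ∈ [51/40, 653/216]`,
`(colM v).x + λ·(colM v).y ≤ 0` on the reached state `v = brunA w ω`.  (`λ = 23/8`: facet `L2` of `K_ψ`; the interval covers the
Perron root `λ₊ = (15+√65)/8` of the hub letter — gen 66's law (L2).) [this work] -/
theorem colM_x_add_mul_y_nonpos (w : List (ℚ × ℚ)) (hw : ∀ θ ∈ w, 0 ≤ θ.1 + θ.2 ∧ 0 ≤ θ.1 - θ.2)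
    (lam : ℚ) (h1 : 51/40 ≤ lam) (h2 : lam ≤ 653/216) :
    (colM (brunA w omegaA)).x + lam * (colM (brunA w omegaA)).y ≤ 0 := by
  have hK := inKP_brun w hw
  obtain ⟨_, hL2, hL3, hQWl, _, _, _, _, _, _⟩ := hK
  simp only [zP] at hL2 hL3 hQWl
  set x := (colM (brunA w omegaA)).x with hx
  set y := (colM (brunA w omegaA)).y with hy
  -- b = -x - (23/8) y ≥ 0 ; bm = -x - (7/8) y ; bm + b/4 ≥ 0 ; (29/2) b - bm ≥ 0
  have hA : 0 ≤ (2/27 - (lam/2 - 23/16)) := by linarith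
  have hB : 0 ≤ (lam/2 - 23/16) + 4/5 := by linarith
  have hC : 0 ≤ (-x - (23/8)*y) + (4/5) * ((-x - (7/8)*y) - (-x - (23/8)*y)) := by linarith
  have hD : 0 ≤ (-x - (23/8)*y) - (2/27) * ((-x - (7/8)*y) - (-x - (23/8)*y)) := by linarith
  nlinarith [mul_nonneg hA hC, mul_nonneg hB hD]

/-- The law at the three rational points used downstream: `λ = 23/8`, `λ = 51/20`, `λ = 3`. [this work] -/
theorem colM_sign_three_points (w : List (ℚ × ℚ)) (hw : ∀ θ ∈ w, 0 ≤ θ.1 + θ.2 ∧ 0 ≤ θ.1 - θ.2) :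
    (colM (brunA w omegaA)).x + (23/8) * (colM (brunA w omegaA)).y ≤ 0 ∧
    (colM (brunA w omegaA)).x + (51/20) * (colM (brunA w omegaA)).y ≤ 0 ∧
    (colM (brunA w omegaA)).x + 3 * (colM (brunA w omegaA)).y ≤ 0 :=
  ⟨colM_x_add_mul_y_nonpos w hw (23/8) (by norm_num) (by norm_num),
   colM_x_add_mul_y_nonpos w hw (51/20) (by norm_num) (by norm_num),
   colM_x_add_mul_y_nonpos w hw 3 (by norm_num) (by norm_num)⟩

/-- `β𝕄(g₃, a) = (5/2)·a.x + (51/8)·a.y` for the `y`-generator `g₃ = (−9,4,0)` of the cone `K`. [this work] -/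
theorem betaM_g3 (a : V3) : betaM ⟨-9, 4, 0⟩ a = (5/2) * a.x + (51/8) * a.y := by
  simp only [betaM]; ring

/-- ★ The `y`-generator `g₃ = (−9,4,0)` of `K` pairs NONPOSITIVELY with the visible column: `β𝕄(g₃, m₋(w)) ≤ 0` for every
physical word (`λ = 51/20` in `colM_x_add_mul_y_nonpos`). [this work] -/
theorem betaM_g3_colM_nonpos (w : List (ℚ × ℚ)) (hw : ∀ θ ∈ w, 0 ≤ θ.1 + θ.2 ∧ 0 ≤ θ.1 - θ.2) :
    betaM ⟨-9, 4, 0⟩ (colM (brunA w omegaA)) ≤ 0 := by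
  rw [betaM_g3]
  have h := colM_x_add_mul_y_nonpos w hw (51/20) (by norm_num) (by norm_num)
  linarith

/-- Hence `β𝕄(c·g₃, m₋(w)) ≥ 0` for every `c ≤ 0`: the `g₃`-component of any vector of `−K` (e.g. of `m₊(u) = colP`, which lies in
`−K` by `colP_negK`) pairs nonnegatively with `m₋(w)`.  This is the `E`-plane part of the sign of the pair term `β𝕄(m₋, m'₊)`. [this work] -/
theorem betaM_colM_smul_g3_nonneg (w : List (ℚ × ℚ)) (hw : ∀ θ ∈ w, 0 ≤ θ.1 + θ.2 ∧ 0 ≤ θ.1 - θ.2) (c : ℚ) (hc : c ≤ 0) :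
    0 ≤ betaM (colM (brunA w omegaA)) ⟨-9 * c, 4 * c, 0⟩ := by
  have h := betaM_g3_colM_nonpos w hw
  rw [betaM_g3] at h
  have e : betaM (colM (brunA w omegaA)) ⟨-9 * c, 4 * c, 0⟩ =
      c * ((5/2) * (colM (brunA w omegaA)).x + (51/8) * (colM (brunA w omegaA)).y) := by
    simp only [betaM]; ring
  rw [e]
  exact mul_nonneg_of_nonpos_of_nonpos hc h

/-- The `g₃`-coordinate of `m₊(u)` is nonpositive (cone law `colP_negK`), so the `g₃`-part of `m₊(u)` pairs nonnegatively with `m₋(w)`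
for ANY two physical words `u, w`. [this work] -/
theorem betaM_colM_colP_g3part_nonneg (u w : List (ℚ × ℚ)) (hu : ∀ θ ∈ u, 0 ≤ θ.1 + θ.2 ∧ 0 ≤ θ.1 - θ.2)
    (hw : ∀ θ ∈ w, 0 ≤ θ.1 + θ.2 ∧ 0 ≤ θ.1 - θ.2) :
    0 ≤ betaM (colM (brunA w omegaA)) ⟨-9 * c3 (colP (brunA u omegaA)), 4 * c3 (colP (brunA u omegaA)), 0⟩ := by
  obtain ⟨_, _, h3⟩ := colP_negK u hu
  exact betaM_colM_smul_g3_nonneg w hw _ h3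

end Summit.CriticalPhenomena.PercolationContinuityZ3.Theorems.ProductFormABPlus
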